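import Summits.CriticalPhenomena.CardyFormulaZ2.Theorems.CardyComplexConeEdgePrecompactUFRSSummation

/-!
# Uniform forward response stability from SCREENED arm domination
(line `qkz-strip-boundary-arm` of crux `CardyComplexCone.EdgePrecompact`, stmt-CriticalPhenomena-11387;
items 5–6 of the road map for the uniform forward response stability "UFRS", module docstring of
`Theorems/CardyComplexConeEdgePrecompactUniformForwardResponseStability.lean`)

`ufrs_of_armDomination` (`…EdgePrecompactUFRSSummation.lean`) derives the UFRS clause for ONE
Dobrushin domain `D` from arm domination (H₁), a PER-BOX arm decay (H₂)/(H₂') and a box count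
(H₃) of the collar, by a union bound over the `η`-boxes meeting `∂D`; item 6 of the road map
explains that (H₃) with exponent `s < 1 + α` fails for rough Jordan curves, although UFRS is very
plausibly true for all of them (screening of percolation arms in fjords). This file records the
form of the summation that does NOT see the regularity of `∂D` (`ufrs_of_screenedArmDomination`,
registered sub-goal, formulated by worker W1 of lead c1; CONDITIONAL on its hypotheses):

* (H₁) ARM DOMINATION, verbatim as in `ufrs_of_armDomination` (deterministic; items 3–4, NOT
  proved in the tree): a forward-response failure at a `2ρ`-deep ball of radius `ρ ≥ 4η`, shift
  `‖E.δ w‖ < η`, lies in `A E w z (4η) (ρ/2)` for a collar point `z`, or in `B E w η ρ`;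
* (H₂ˢ) SCREENED COLLAR DECAY (probabilistic, NOT proved and not in print for rough `∂D`): for
  every `ρ, ε > 0` there is `η₁ > 0` such that for all `0 < η < η₁` and fine enough admissible data,
  the probability that SOME collar point `z` has `ω ∈ A E w z (4η) (ρ/2)` is at most `ε` — the
  statement a screening lemma would prove directly, and which the union bound of
  `ufrs_of_armDomination` proves from (H₂) + (H₃) when `∂D` has upper box dimension `< 1 + α`;
* (H₂'ˢ) the same for the marked-point event `B E w η ρ`.

Conclusion: the UFRS clause for `D` (verbatim the body of `stub_uniformForwardResponseStability`
at `D`). Proof: choose `η` below both thresholds and below `ρ/4`, take the three mesh thresholds,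
and bound the failure event by the union (H₁) of two events of probability `≤ ε/2`.

References: G. F. Lawler, O. Schramm, W. Werner, Electron. J. Probab. 7 (2002), Appendix A;
P. Nolin, Electron. J. Probab. 13 (2008), §4; C. Garban, G. Pete, O. Schramm, J. Amer. Math. Soc.
26 (2013), §5.
-/

namespace Summit.CriticalPhenomena.CardyFormulaZ2.Cruxes.EdgePrecompact.QkzStripBoundaryArm

open MeasureTheory Filter Set Metric
open scoped Topology BigOperators Pointwise
open Literature.Probability.LatticeModels Literature.Probability.Percolation
open Literature.Probability.RandomPlanarGeometry (DobrushinDomain)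
open Summit.CriticalPhenomena.CardyFormulaZ2.Theses.CardyComplexCone

noncomputable section

/-- **UFRS for `D` from screened arm domination** (registered sub-goal
`ufrs_of_screenedArmDomination` of stmt-CriticalPhenomena-11387; items 5–6 of the UFRS road map;
CONDITIONAL on (H₁) arm domination, (H₂ˢ) screened collar decay, (H₂'ˢ) marked-point decay — see
the module docstring). The conclusion is verbatim the clause of
`stub_uniformForwardResponseStability` at the domain `D`. -/
theorem ufrs_of_screenedArmDomination : ∀ (D : DobrushinDomain) (A : DiscreteDobrushin → Site 2 → ℂ → ℝ → ℝ → Set (BondConfig (Site 2))) (B : DiscreteDobrushin → Site 2 → ℝ → ℝ → Set (BondConfig (Site 2))), (∀ η > (0:ℝ), ∃ δ₀ > (0:ℝ), ∀ E : DiscreteDobrushin, E.Ω = D.carrier → E.IsZdAdmissible → E.δ < δ₀ → ∀ (v w : Site 2) (ρ : ℝ), 4 * η ≤ ρ → 2 * ρ ≤ infDist (meshPoint E.δ v) D.carrierᶜ → ‖meshPoint E.δ w‖ < η → ∀ ω : BondConfig (Site 2), (¬ ∀ a a' : Site 2 × Fin 4, ((E.IsStartCorner a ∧ (shiftData E w).IsStartCorner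 a') ∨ (a = a' ∧ medialPoint E.δ (cSrc a) ∈ ball (meshPoint E.δ v) ρ ∧ medialPoint E.δ (cTgt a) ∉ ball (meshPoint E.δ v) ρ)) → ∀ n : ℕ, (∀ i < n, medialPoint E.δ (cTgt (cornerOrbit (E.bcBondConfig ω) a i)) ∉ ball (meshPoint E.δ v) ρ ∧ E.IsInnerFace (cFace (cornerOrbit (E.bcBondConfig ω) a (i + 1)))) → medialPoint E.δ (cTgt (cornerOrbit (E.bcBondConfig ω) a n)) ∈ ball (meshPoint E.δ v) ρ → ∃ n' : ℕ, (∀ i < n', medialPoint E.δ (cTgt (cornerOrbit ((shiftData E w).bcBondConfig ω) a' i)) ∉ ball (meshPoint E.δ v) ρ ∧ (shiftData E w).IsInnerFace (cFace (cornerOrbit ((shiftData E w).bcBondConfig ω) a' (i + 1)))) ∧ cornerOrbit ((shiftData E w).bcBondConfig ω) a' n' = cornerOrbit (E.bcBondConfig ω) a n ∧ ∑ i ∈ Finset.range n', turnOf ((shiftData E w).bcBondConfig ω) (cornerOrbit ((shiftData E w).bcBondConfig ω) a' i) = ∑ i ∈ Finset.range n, turnOf (E.bcBondConfig ω) (cornerOrbit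 (E.bcBondConfig ω) a i)) → (∃ z ∈ D.carrier, infDist z D.carrierᶜ < 3 * η ∧ ω ∈ A E w z (4 * η) (ρ / 2)) ∨ ω ∈ B E w η ρ) → (∀ ρ > (0:ℝ), ∀ ε > (0:ℝ), ∃ η₁ > (0:ℝ), ∀ η : ℝ, 0 < η → η < η₁ → ∃ δ₀ > (0:ℝ), ∀ E : DiscreteDobrushin, E.Ω = D.carrier → E.IsZdAdmissible → E.δ < δ₀ → ∀ w : Site 2, ‖meshPoint E.δ w‖ < η → (bondPercolation (zdGraph 2) half).real {ω : BondConfig (Site 2) | ∃ z ∈ D.carrier, infDist z D.carrierᶜ < 3 * η ∧ ω ∈ A E w z (4 * η) (ρ / 2)} ≤ ε) → (∀ ρ > (0:ℝ), ∀ ε > (0:ℝ), ∃ η₁ > (0:ℝ), ∀ η : ℝ, 0 < η → η < η₁ → ∃ δ₀ > (0:ℝ), ∀ E : DiscreteDobrushin, E.Ω = D.carrier → E.IsZdAdmissible → E.δ < δ₀ → ∀ w : Site 2, ‖meshPoint E.δ w‖ < η → (bondPercolation (zdGraph 2) half).real (B E w η ρ) ≤ ε) → ∀ K : Set ℂ,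 IsCompact K → K ⊆ D.carrier → ∀ ρ > (0:ℝ), cthickening (2 * ρ) K ⊆ D.carrier → ∀ ε > (0:ℝ), ∃ η > (0:ℝ), ∃ δ₀ > (0:ℝ), ∀ E : DiscreteDobrushin, E.Ω = D.carrier → E.IsZdAdmissible → E.δ < δ₀ → ∀ v w : Site 2, meshPoint E.δ v ∈ K → ‖meshPoint E.δ w‖ < η → (bondPercolation (zdGraph 2) half).real {ω : BondConfig (Site 2) | ¬ ∀ a a' : Site 2 × Fin 4, ((E.IsStartCorner a ∧ (shiftData E w).IsStartCorner a') ∨ (a = a' ∧ medialPoint E.δ (cSrc a) ∈ ball (meshPoint E.δ v) ρ ∧ medialPoint E.δ (cTgt a) ∉ ball (meshPoint E.δ v) ρ)) → ∀ n : ℕ, (∀ i < n, medialPoint E.δ (cTgt (cornerOrbit (E.bcBondConfig ω) a i)) ∉ ball (meshPoint E.δ v) ρ ∧ E.IsInnerFace (cFace (cornerOrbit (E.bcBondConfig ω) a (i + 1)))) → medialPoint E.δ (cTgt (cornerOrbit (E.bcBondConfig ω) a n)) ∈ ball (meshPoint E.δ v) ρ → ∃ n' : ℕ, (∀ i < n',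 medialPoint E.δ (cTgt (cornerOrbit ((shiftData E w).bcBondConfig ω) a' i)) ∉ ball (meshPoint E.δ v) ρ ∧ (shiftData E w).IsInnerFace (cFace (cornerOrbit ((shiftData E w).bcBondConfig ω) a' (i + 1)))) ∧ cornerOrbit ((shiftData E w).bcBondConfig ω) a' n' = cornerOrbit (E.bcBondConfig ω) a n ∧ ∑ i ∈ Finset.range n', turnOf ((shiftData E w).bcBondConfig ω) (cornerOrbit ((shiftData E w).bcBondConfig ω) a' i) = ∑ i ∈ Finset.range n, turnOf (E.bcBondConfig ω) (cornerOrbit (E.bcBondConfig ω) a i)} ≤ ε := by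
  intro D A B hDom hA hB K _hK _hKD ρ hρ hρK ε hε
  set μ := bondPercolation (zdGraph 2) half with hμ
  have hε2 : 0 < ε / 2 := by positivity
  obtain ⟨η₁, hη₁, hA₁⟩ := hA ρ hρ (ε / 2) hε2
  obtain ⟨η₂, hη₂, hB₂⟩ := hB ρ hρ (ε / 2) hε2
  -- the collar scale
  set η : ℝ := min (min η₁ η₂) (ρ / 4) / 2 with hηdef
  have hmpos : 0 < min (min η₁ η₂) (ρ / 4) := lt_min (lt_min hη₁ hη₂) (by positivity)
  have hη0 : 0 < η := by rw [hηdef]; positivity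
  have hηlt : η < min (min η₁ η₂) (ρ / 4) := by rw [hηdef]; linarith
  have hη₁' : η < η₁ := lt_of_lt_of_le hηlt ((min_le_left _ _).trans (min_le_left _ _))
  have hη₂' : η < η₂ := lt_of_lt_of_le hηlt ((min_le_left _ _).trans (min_le_right _ _))
  have hηρ : 4 * η ≤ ρ := by
    have := lt_of_lt_of_le hηlt (min_le_right _ _)
    linarith
  -- the mesh thresholds
  obtain ⟨δ₁, hδ₁, hDom₁⟩ := hDom η hη0
  obtain ⟨δ₂, hδ₂, hA₂⟩ := hA₁ η hη0 hη₁'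
  obtain ⟨δ₃, hδ₃, hB₃⟩ := hB₂ η hη0 hη₂'
  refine ⟨η, hη0, min δ₁ (min δ₂ δ₃), lt_min hδ₁ (lt_min hδ₂ hδ₃), ?_⟩
  intro E hEΩ hE hEδ v w hvK hw
  have hEδ₁ : E.δ < δ₁ := lt_of_lt_of_le hEδ (min_le_left _ _)
  have hEδ₂ : E.δ < δ₂ := lt_of_lt_of_le hEδ ((min_le_right _ _).trans (min_le_left _ _))
  have hEδ₃ : E.δ < δ₃ := lt_of_lt_of_le hEδ ((min_le_right _ _).trans (min_le_right _ _))
  have hv : 2 * ρ ≤ infDist (meshPoint E.δ v) D.carrierᶜ := two_rho_le_infDist D hρK hvK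
  -- domination
  have hsub : {ω : BondConfig (Site 2) | ¬ ∀ a a' : Site 2 × Fin 4, ((E.IsStartCorner a ∧ (shiftData E w).IsStartCorner a') ∨ (a = a' ∧ medialPoint E.δ (cSrc a) ∈ ball (meshPoint E.δ v) ρ ∧ medialPoint E.δ (cTgt a) ∉ ball (meshPoint E.δ v) ρ)) → ∀ n : ℕ, (∀ i < n, medialPoint E.δ (cTgt (cornerOrbit (E.bcBondConfig ω) a i)) ∉ ball (meshPoint E.δ v) ρ ∧ E.IsInnerFace (cFace (cornerOrbit (E.bcBondConfig ω) a (i + 1)))) → medialPoint E.δ (cTgt (cornerOrbit (E.bcBondConfig ω) a n)) ∈ ball (meshPoint E.δ v) ρ → ∃ n' : ℕ, (∀ i < n', medialPoint E.δ (cTgt (cornerOrbit ((shiftData E w).bcBondConfig ω) a' i)) ∉ ball (meshPoint E.δ v) ρ ∧ (shiftData E w).IsInnerFace (cFace (cornerOrbit ((shiftData E w).bcBondConfig ω) a' (i + 1)))) ∧ cornerOrbit ((shiftData E w).bcBondConfig ω) a' n' = cornerOrbit (E.bcBondConfig ω) a n ∧ ∑ i ∈ Finset.range n', turnOf ((shiftData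 E w).bcBondConfig ω) (cornerOrbit ((shiftData E w).bcBondConfig ω) a' i) = ∑ i ∈ Finset.range n, turnOf (E.bcBondConfig ω) (cornerOrbit (E.bcBondConfig ω) a i)} ⊆
      {ω : BondConfig (Site 2) | ∃ z ∈ D.carrier, infDist z D.carrierᶜ < 3 * η ∧ ω ∈ A E w z (4 * η) (ρ / 2)} ∪ B E w η ρ := by
    intro ω hω
    rcases hDom₁ E hEΩ hE hEδ₁ v w ρ hηρ hv hw ω hω with h | h
    · exact Or.inl h
    · exact Or.inr h
  calc μ.real _ ≤ μ.real ({ω : BondConfig (Site 2) | ∃ z ∈ D.carrier, infDist z D.carrierᶜ < 3 * η ∧ ω ∈ A E w z (4 * η) (ρ / 2)} ∪ B E w η ρ) :=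
        measureReal_mono hsub
    _ ≤ μ.real {ω : BondConfig (Site 2) | ∃ z ∈ D.carrier, infDist z D.carrierᶜ < 3 * η ∧ ω ∈ A E w z (4 * η) (ρ / 2)} + μ.real (B E w η ρ) :=
        measureReal_union_le _ _
    _ ≤ ε / 2 + ε / 2 := add_le_add (hA₂ E hEΩ hE hEδ₂ w hw) (hB₃ E hEΩ hE hEδ₃ w hw)
    _ = ε := by ring

end

end Summit.CriticalPhenomena.CardyFormulaZ2.Cruxes.EdgePrecompact.QkzStripBoundaryArm
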